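import Literature.RingTheory.HilbertSamuel.ProjDirectrixGenerators
import Mathlib.RingTheory.Nakayama
import Mathlib.LinearAlgebra.FiniteDimensional.Lemmas
import HarnessLib

/-!
# `e(A) = 2`: the directrix is a plane — two generators of `𝔪` adapted to the directrix, the exceptional ideal at a
# point of `ℙ(Dir(A))` is generated by them, and every element of `𝔪` is a combination of the two up to
# `(𝔪B)·𝔪_B` (CJS 2020, Def. 2.18 / Def. 6.34 (i) / Def. 6.38 (ii), p. 103, p. 105)

Topic: `Literature/RingTheory/HilbertSamuel`. Ring-level core of the tree proof of the named fact
`Literature.AlgebraicGeometry.CossartJannsenSaito2020.ProjDir_projLine` (CJS LNM 2270, Def. 6.38 (ii) / p. 105 L13: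
«`C_1 = ℙ(Dir_x(X)) ≅ ℙ^1_{k(x)}`» at `e_x(X) = 2`), the `e = 2` sibling of `ProjDirectrixLine.lean` (`e = 1`), continuing
`ProjDirectrixGenerators.lean`. Let `A` be a noetherian local ring with residue field `k`, `x_1, …, x_e` a minimal system of
generators of `𝔪`, `J = J_x` the tangent cone ideal, `𝒯 = 𝒯(J) ⊆ S_1` its directrix space, so `e(A) = e − dim_k 𝒯`; let
`c_1, …, c_r` be any generators of `𝔪` with expansions `c_l = Σ_i a_{li} x_i` and symbols `s_l = Σ_i ā_{li} X_i`. Assume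
**`e(A) = 2`**, i.e. `𝒯` has CODIMENSION TWO in `S_1`. PROVED:

* `exists_pair_symbols_compl_directrixSpace` — **two generators adapted to the directrix**: there are indices `j, j'` such
  that `s_j ∉ 𝒯` and `s_{j'} ∉ 𝒯 + k s_j`; then `S_1 = 𝒯 ⊕ k s_j ⊕ k s_{j'}`: every linear form is
  `L ≡ α s_j + β s_{j'} (mod 𝒯)` (`exists_sub_sub_mem_of_pair`) with `α, β` unique (`eq_zero_of_pair_mem`);
* `exists_forall_map_sub_sub_mem_of_pair` — **ratios**: for every `y ∈ 𝔪` there are `α, β ∈ A`, depending on `y` only,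
  with `φ(y) − φ(α)φ(c_j) − φ(β)φ(c_{j'}) ∈ (𝔪B)·𝔪_B` for every `φ : A → B` into a local ring with `φ(𝔪) ⊆ 𝔪_B` and
  `ProjDirLiftsInto φ x` («`ξ ∈ ℙ(Dir(A))`»; the lift `y − α c_j − β c_{j'}` of the directrix form `ȳ − ᾱ s_j − β̄ s_{j'}`);
* `map_maximalIdeal_eq_span_pair_of_projDirLiftsInto` — **the exceptional ideal at a point of `ℙ(Dir)` is `(φ c_j, φ c_{j'})`**
  (Nakayama), so that `ℙ(Dir_x(X))` lies in the union of the two blow-up charts at `c_j` and `c_{j'}`.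

Everything here is PROVED; no named facts.

## References

* V. Cossart, U. Jannsen, S. Saito, *Desingularization: Invariants and Strategy*, LNM 2270 (2020), Lemma 2.7,
  Def. 2.18, Def. 2.26, Def. 6.34 (i), Def. 6.38 (ii), p. 103, p. 105. [CossartJannsenSaito2020]
-/

noncomputable section

open IsLocalRing MvPolynomial Module
open Literature.AlgebraicGeometry.Resolution Literature.RingTheory.MvPolynomial

namespace Literature.RingTheory.HilbertSamuel

universe u v w

/-! ## Linear algebra: a subspace of codimension two and two vectors complementing it -/

section LinearAlgebra

variable {k : Type v} [Field k] {V : Type w} [AddCommGroup V] [Module k V]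

/-- Adjoining a vector off a finite-dimensional subspace raises the dimension by exactly one. [folklore] -/
private theorem finrank_sup_span_singleton {T : Submodule k V} [FiniteDimensional k T] {v : V} (hv : v ∉ T) :
    finrank k ↥(T ⊔ k ∙ v) = finrank k T + 1 := by
  have hv0 : v ≠ 0 := fun h => hv (h ▸ T.zero_mem)
  haveI : FiniteDimensional k ↥(k ∙ v) := FiniteDimensional.span_singleton k v
  have hinf : T ⊓ (k ∙ v) = ⊥ := by
    refine (Submodule.eq_bot_iff _).mpr fun w hw => ?_
    obtain ⟨hwT, hwv⟩ := Submodule.mem_inf.mp hw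
    obtain ⟨a, rfl⟩ := Submodule.mem_span_singleton.mp hwv
    by_cases ha : a = 0
    · rw [ha, zero_smul]
    · exact absurd (by simpa [smul_smul, inv_mul_cancel₀ ha] using T.smul_mem a⁻¹ hwT) hv
  have h := Submodule.finrank_sup_add_finrank_inf_eq T (k ∙ v)
  rw [hinf, finrank_bot, add_zero, finrank_span_singleton hv0] at h
  exact h

/-- **A spanning family of `S` contains two vectors complementing a codimension-two subspace `T ≤ S`.** If `T ≤ S` with
`dim T + 2 = dim S < ∞` and the `v_l ∈ S` span `S`, then some `v_j ∉ T` and some `v_{j'} ∉ T + k v_j`. [folklore] -/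
private theorem exists_pair_of_finrank_add_two {T S : Submodule k V} [FiniteDimensional k S] (hTS : T ≤ S)
    (hrank : finrank k T + 2 = finrank k S) {ι : Type*} {v : ι → V} (hvS : ∀ l, v l ∈ S)
    (hspan : S ≤ Submodule.span k (Set.range v)) :
    ∃ j j', v j ∉ T ∧ v j' ∉ T ⊔ k ∙ v j := by
  haveI : FiniteDimensional k T := Submodule.finiteDimensional_of_le hTS
  -- a first vector off `T`
  have h1 : ∃ j, v j ∉ T := by
    by_contra hall
    simp only [not_exists, not_not] at hall
    have hST : S ≤ T := hspan.trans (Submodule.span_le.mpr (by rintro _ ⟨l, rfl⟩; exact hall l))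
    have := Submodule.finrank_mono hST
    omega
  obtain ⟨j, hj⟩ := h1
  -- a second vector off `T + k v_j`
  have hT1S : T ⊔ k ∙ v j ≤ S := sup_le hTS ((Submodule.span_singleton_le_iff_mem _ _).mpr (hvS j))
  haveI : FiniteDimensional k ↥(T ⊔ k ∙ v j) := Submodule.finiteDimensional_of_le hT1S
  have hrank1 : finrank k ↥(T ⊔ k ∙ v j) = finrank k T + 1 := finrank_sup_span_singleton hj
  have h2 : ∃ j', v j' ∉ T ⊔ k ∙ v j := by
    by_contra hall
    simp only [not_exists, not_not] at hall
    have hST : S ≤ T ⊔ k ∙ v j :=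
      hspan.trans (Submodule.span_le.mpr (by rintro _ ⟨l, rfl⟩; exact hall l))
    have := Submodule.finrank_mono hST
    omega
  obtain ⟨j', hj'⟩ := h2
  exact ⟨j, j', hj, hj'⟩

/-- With `T ≤ S`, `dim T + 2 = dim S`, `v_1 ∈ S ∖ T`, `v_2 ∈ S ∖ (T + k v_1)`: every `m ∈ S` is `≡ α v_1 + β v_2 (mod T)`.
[folklore] -/
private theorem exists_sub_sub_mem_of_finrank_add_two {T S : Submodule k V} [FiniteDimensional k S] (hTS : T ≤ S)
    (hrank : finrank k T + 2 = finrank k S) {v₁ v₂ : V} (hv₁S : v₁ ∈ S) (hv₂S : v₂ ∈ S) (hv₁ : v₁ ∉ T)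
    (hv₂ : v₂ ∉ T ⊔ k ∙ v₁) {m : V} (hm : m ∈ S) :
    ∃ α β : k, m - α • v₁ - β • v₂ ∈ T := by
  haveI : FiniteDimensional k T := Submodule.finiteDimensional_of_le hTS
  have hT1S : T ⊔ k ∙ v₁ ≤ S := sup_le hTS ((Submodule.span_singleton_le_iff_mem _ _).mpr hv₁S)
  haveI : FiniteDimensional k ↥(T ⊔ k ∙ v₁) := Submodule.finiteDimensional_of_le hT1S
  have hT2S : (T ⊔ k ∙ v₁) ⊔ k ∙ v₂ ≤ S := sup_le hT1S ((Submodule.span_singleton_le_iff_mem _ _).mpr hv₂S)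
  haveI : FiniteDimensional k ↥((T ⊔ k ∙ v₁) ⊔ k ∙ v₂) := Submodule.finiteDimensional_of_le hT2S
  have hrank2 : finrank k ↥((T ⊔ k ∙ v₁) ⊔ k ∙ v₂) = finrank k S := by
    rw [finrank_sup_span_singleton hv₂, finrank_sup_span_singleton hv₁, ← hrank]
  have heq : (T ⊔ k ∙ v₁) ⊔ k ∙ v₂ = S := Submodule.eq_of_le_of_finrank_le hT2S hrank2.ge
  rw [← heq] at hm
  obtain ⟨y, hy, z, hz, rfl⟩ := Submodule.mem_sup.mp hm
  obtain ⟨t, ht, w, hw, rfl⟩ := Submodule.mem_sup.mp hy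
  obtain ⟨α, rfl⟩ := Submodule.mem_span_singleton.mp hw
  obtain ⟨β, rfl⟩ := Submodule.mem_span_singleton.mp hz
  refine ⟨α, β, ?_⟩
  have h1 : t + α • v₁ + β • v₂ - α • v₁ - β • v₂ = t := by abel
  rw [h1]
  exact ht

/-- Uniqueness: if `α v_1 + β v_2 ∈ T` with `v_1 ∉ T`, `v_2 ∉ T + k v_1`, then `α = β = 0`. [folklore] -/
private theorem eq_zero_of_smul_add_smul_mem {T : Submodule k V} {v₁ v₂ : V} (hv₁ : v₁ ∉ T)
    (hv₂ : v₂ ∉ T ⊔ k ∙ v₁) {α β : k} (h : α • v₁ + β • v₂ ∈ T) : α = 0 ∧ β = 0 := by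
  have hβ : β = 0 := by
    by_contra hβ
    apply hv₂
    have h1 : v₂ = β⁻¹ • (α • v₁ + β • v₂) - (β⁻¹ * α) • v₁ := by
      rw [smul_add, smul_smul, smul_smul, inv_mul_cancel₀ hβ, one_smul, add_sub_cancel_left]
    rw [h1]
    exact Submodule.sub_mem _ (Submodule.mem_sup_left (T.smul_mem _ h))
      (Submodule.mem_sup_right (Submodule.smul_mem _ _ (Submodule.mem_span_singleton_self _)))
  subst hβ
  rw [zero_smul, add_zero] at h
  refine ⟨?_, rfl⟩
  by_contra hα
  exact hv₁ (by simpa [smul_smul, inv_mul_cancel₀ hα] using T.smul_mem α⁻¹ h)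

end LinearAlgebra

/-! ## Linear forms: coefficients -/

section LinearForms

variable {k : Type v} [Field k] {e : ℕ}

/-- The `X_i`-coefficient of `Σ v_j X_j` is `v_i`. [folklore] -/
private theorem coeff_single_one_linForm'' (v : Fin e → k) (i : Fin e) :
    MvPolynomial.coeff (Finsupp.single i 1) (linForm v) = v i := by
  classical
  rw [linForm_apply, MvPolynomial.coeff_sum]
  simp_rw [MvPolynomial.coeff_smul, MvPolynomial.coeff_X, smul_eq_mul]
  rw [Finset.sum_eq_single i]
  · simp
  · intro j _ hj
    rw [if_neg, mul_zero]
    exact fun h => hj (Finsupp.single_left_injective one_ne_zero h)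
  · exact fun h => absurd (Finset.mem_univ i) h

end LinearForms

/-! ## `e(A) = 2`: two generators adapted to the directrix -/

section Plane

variable {A : Type u} [CommRing A] [IsLocalRing A] [IsNoetherianRing A] {e : ℕ} {x : Fin e → A}
  (hx : Ideal.span (Set.range x) = maximalIdeal A) (he : (maximalIdeal A).spanFinrank = e)
  {r : ℕ} {c : Fin r → A} (hc : Ideal.span (Set.range c) = maximalIdeal A)
  (a : Fin r → Fin e → A) (hca : ∀ l, c l = ∑ i, a l i * x i)

include he hc hca in
/-- **Two generators adapted to the directrix plane.** If `e(A) = 2` then among any generators `c_1, …, c_r` of `𝔪` (with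
expansions `c_l = Σ_i a_{li} x_i` in a minimal system `x`) there are `c_j`, `c_{j'}` whose symbols `s_j`, `s_{j'}` satisfy
`s_j ∉ 𝒯` and `s_{j'} ∉ 𝒯 + k s_j` — so that `S_1 = 𝒯 ⊕ k s_j ⊕ k s_{j'}` (the symbols span `S_1`, `X_mem_span_symbol`).
[cite: CossartJannsenSaito2020, Lemma 2.7, Def. 2.18] -/
theorem exists_pair_symbols_compl_directrixSpace (hd : directrixDim (tangentConeIdeal x hx) = 2) :
    ∃ j j', linForm (fun i => residue A (a j i)) ∉ directrixSpace (tangentConeIdeal x hx) ∧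
      linForm (fun i => residue A (a j' i)) ∉
        directrixSpace (tangentConeIdeal x hx) ⊔ (ResidueField A) ∙ linForm (fun i => residue A (a j i)) := by
  set T := directrixSpace (tangentConeIdeal x hx) with hT
  set S := homogeneousSubmodule (Fin e) (ResidueField A) 1 with hS
  haveI : FiniteDimensional (ResidueField A) S := by
    rw [hS, ← range_linForm]; infer_instance
  have hTS : T ≤ S := directrixSpace_le_one _
  have hrank : finrank (ResidueField A) T + 2 = finrank (ResidueField A) S := by
    rw [hS, finrank_homogeneousSubmodule_one, ← hd]
    exact finrank_directrixSpace_add_directrixDim _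
  have hvS : ∀ l, linForm (fun i => residue A (a l i)) ∈ S := fun l => by
    rw [hS, ← range_linForm]; exact LinearMap.mem_range_self _ _
  have hspan : S ≤ Submodule.span (ResidueField A) (Set.range fun l => linForm fun i => residue A (a l i)) := by
    rw [hS, homogeneousSubmodule_one_eq_span_X, Submodule.span_le]
    rintro _ ⟨i, rfl⟩
    exact X_mem_span_symbol hx he hc a hca i
  exact exists_pair_of_finrank_add_two hTS hrank hvS hspan

variable {j j' : Fin r}
  (hj : linForm (fun i => residue A (a j i)) ∉ directrixSpace (tangentConeIdeal x hx))
  (hj' : linForm (fun i => residue A (a j' i)) ∉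
    directrixSpace (tangentConeIdeal x hx) ⊔ (ResidueField A) ∙ linForm (fun i => residue A (a j i)))

omit [IsNoetherianRing A] in
include hj hj' in
/-- Every linear form is `≡ α s_j + β s_{j'}` modulo the directrix space `𝒯` (codimension two).
[cite: CossartJannsenSaito2020, Lemma 2.7, Def. 2.18] -/
theorem exists_sub_sub_mem_of_pair (hd : directrixDim (tangentConeIdeal x hx) = 2)
    {L : MvPolynomial (Fin e) (ResidueField A)} (hL : L ∈ homogeneousSubmodule (Fin e) (ResidueField A) 1) :
    ∃ α β : ResidueField A, L - α • linForm (fun i => residue A (a j i)) - β • linForm (fun i => residue A (a j' i)) ∈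
      directrixSpace (tangentConeIdeal x hx) := by
  set S := homogeneousSubmodule (Fin e) (ResidueField A) 1 with hS
  haveI : FiniteDimensional (ResidueField A) S := by
    rw [hS, ← range_linForm]; infer_instance
  have hTS : directrixSpace (tangentConeIdeal x hx) ≤ S := directrixSpace_le_one _
  have hrank : finrank (ResidueField A) (directrixSpace (tangentConeIdeal x hx)) + 2 = finrank (ResidueField A) S := by
    rw [hS, finrank_homogeneousSubmodule_one, ← hd]
    exact finrank_directrixSpace_add_directrixDim _
  have hvS : ∀ l, linForm (fun i => residue A (a l i)) ∈ S := fun l => by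
    rw [hS, ← range_linForm]; exact LinearMap.mem_range_self _ _
  exact exists_sub_sub_mem_of_finrank_add_two hTS hrank (hvS j) (hvS j') hj hj' hL

omit [IsNoetherianRing A] in
include hj hj' in
/-- Uniqueness of the coefficients: `α s_j + β s_{j'} ∈ 𝒯` forces `α = β = 0`. [cite: CossartJannsenSaito2020, Lemma 2.7, Def. 2.18] -/
theorem eq_zero_of_pair_mem {α β : ResidueField A}
    (h : α • linForm (fun i => residue A (a j i)) + β • linForm (fun i => residue A (a j' i)) ∈
      directrixSpace (tangentConeIdeal x hx)) : α = 0 ∧ β = 0 :=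
  eq_zero_of_smul_add_smul_mem hj hj' h

/-! ## `e(A) = 2`: ratios and the exceptional ideal at a point of `ℙ(Dir)` -/

variable {B : Type w} [CommRing B] [IsLocalRing B]

omit [IsNoetherianRing A] in
include hca hj hj' in
/-- **Ratios at a point of `ℙ(Dir(A))`, `e(A) = 2`.** For every `y ∈ 𝔪` there are `α, β ∈ A` — depending on `y` only —
such that for every `φ : A → B` into a local ring with `φ(𝔪) ⊆ 𝔪_B` and `ProjDirLiftsInto φ x`:
`φ(y) − φ(α)φ(c_j) − φ(β)φ(c_{j'}) ∈ (𝔪_A B)·𝔪_B`. Writing `y = Σ y_i x_i`, the form `ȳ − ᾱ s_j − β̄ s_{j'}` (with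
`ȳ = Σ ȳ_i X_i`) is chosen in `𝒯` (`exists_sub_sub_mem_of_pair`), and `y − α c_j − β c_{j'}` is a lift of it.
[cite: CossartJannsenSaito2020, Def. 6.34 (i), Def. 6.38 (ii)] -/
theorem exists_forall_map_sub_sub_mem_of_pair (hd : directrixDim (tangentConeIdeal x hx) = 2)
    {y : A} (hy : y ∈ maximalIdeal A) :
    ∃ α β : A, ∀ (B : Type w) [CommRing B] [IsLocalRing B] (φ : A →+* B),
      (maximalIdeal A).map φ ≤ maximalIdeal B → ProjDirLiftsInto φ x hx →
        φ y - φ α * φ (c j) - φ β * φ (c j') ∈ (maximalIdeal A).map φ * maximalIdeal B := by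
  classical
  -- `y = Σ y_i x_i`
  obtain ⟨yc, hyc⟩ : ∃ yc : Fin e → A, ∑ i, yc i * x i = y :=
    Ideal.mem_span_range_iff_exists_fun.mp (by rw [hx]; exact hy)
  have hL : linForm (fun i => residue A (yc i)) ∈ homogeneousSubmodule (Fin e) (ResidueField A) 1 := by
    rw [← range_linForm]; exact LinearMap.mem_range_self _ _
  obtain ⟨αb, βb, hmem⟩ := exists_sub_sub_mem_of_pair hx a hj hj' hd hL
  obtain ⟨α, rfl⟩ : ∃ α, residue A α = αb := Ideal.Quotient.mk_surjective αb
  obtain ⟨β, rfl⟩ : ∃ β, residue A β = βb := Ideal.Quotient.mk_surjective βb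
  refine ⟨α, β, fun B _ _ φ hφ hP => ?_⟩
  -- the lift `Σ_i (y_i − α a_{ji} − β a_{j'i}) x_i = y − α c_j − β c_{j'}`
  let cf : Fin e → A := fun i => yc i - α * a j i - β * a j' i
  have hcf : ∀ i, residue A (cf i) = MvPolynomial.coeff (Finsupp.single i 1)
      (linForm (fun i => residue A (yc i)) - residue A α • linForm (fun i => residue A (a j i)) -
        residue A β • linForm (fun i => residue A (a j' i))) := by
    intro i
    simp only [cf, MvPolynomial.coeff_sub, MvPolynomial.coeff_smul, coeff_single_one_linForm'', map_sub, map_mul,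
      smul_eq_mul]
  have hval : ∑ i, cf i * x i = y - α * c j - β * c j' := by
    simp only [cf, sub_mul, Finset.sum_sub_distrib, hyc]
    rw [hca j, hca j', Finset.mul_sum, Finset.mul_sum]
    congr 1
    · congr 1
      exact Finset.sum_congr rfl fun i _ => by ring
    · exact Finset.sum_congr rfl fun i _ => by ring
  have h := hP _ hmem cf hcf
  rwa [hval, map_sub, map_sub, map_mul, map_mul] at h

omit [IsNoetherianRing A] in
include hca hj hj' in
/-- **`𝔪·B = (φ(c_j), φ(c_{j'}))` at a point of `ℙ(Dir(A))` when `e(A) = 2`** (CJS p. 103/p. 105: the exceptional divisor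
near `C_1 = ℙ(Dir_x) ≅ ℙ^1` is cut out by two parameters): for `φ : A → B` into a local ring with `φ(𝔪) ⊆ 𝔪_B` and
`ProjDirLiftsInto φ x`, and `c_j`, `c_{j'}` adapted to the directrix, `𝔪B = (φ c_j, φ c_{j'})`. Proof:
`φ(x_i) ∈ (φ c_j, φ c_{j'}) + (𝔪B)𝔪_B` (`exists_forall_map_sub_sub_mem_of_pair`), and Nakayama.
[cite: CossartJannsenSaito2020, Def. 6.34 (i), Def. 6.38 (ii)] -/
theorem map_maximalIdeal_eq_span_pair_of_projDirLiftsInto (hd : directrixDim (tangentConeIdeal x hx) = 2)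
    (φ : A →+* B) (hφ : (maximalIdeal A).map φ ≤ maximalIdeal B) (hP : ProjDirLiftsInto φ x hx) :
    (maximalIdeal A).map φ = Ideal.span {φ (c j), φ (c j')} := by
  classical
  have hcm : ∀ l, c l ∈ maximalIdeal A := by
    intro l
    rw [hca l, ← hx]
    exact Ideal.sum_mem _ fun i _ => Ideal.mul_mem_left _ _ (Ideal.subset_span ⟨i, rfl⟩)
  apply le_antisymm
  · -- Nakayama
    set N : Ideal B := (maximalIdeal A).map φ with hN
    have hNfg : N.FG := by
      rw [hN, ← hx, Ideal.map_span]
      exact ⟨(Finset.univ.image (φ ∘ x)), by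
        rw [Finset.coe_image, Finset.coe_univ, Set.image_univ, Set.range_comp]⟩
    have hle : N ≤ Ideal.span {φ (c j), φ (c j')} ⊔ maximalIdeal B • N := by
      rw [hN, ← hx, Ideal.map_span, Ideal.span_le]
      rintro _ ⟨_, ⟨i, rfl⟩, rfl⟩
      obtain ⟨α, β, hαβ⟩ := exists_forall_map_sub_sub_mem_of_pair hx a hca hj hj' hd
        (show x i ∈ maximalIdeal A from hx ▸ Ideal.subset_span ⟨i, rfl⟩)
      have hmem := hαβ B φ hφ hP
      have : φ (x i) = (φ α * φ (c j) + φ β * φ (c j')) + (φ (x i) - φ α * φ (c j) - φ β * φ (c j')) := by ring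
      rw [this]
      refine Submodule.add_mem_sup ?_ ?_
      · exact Ideal.add_mem _ (Ideal.mul_mem_left _ _ (Ideal.subset_span (by simp)))
          (Ideal.mul_mem_left _ _ (Ideal.subset_span (by simp)))
      · rw [Ideal.smul_eq_mul, mul_comm (maximalIdeal B), ← Ideal.map_span, hx]
        exact hmem
    exact Submodule.le_of_le_smul_of_le_jacobson_bot hNfg (IsLocalRing.maximalIdeal_le_jacobson ⊥) hle
  · rw [Ideal.span_le]
    rintro _ (rfl | rfl)
    · exact Ideal.mem_map_of_mem φ (hcm j)
    · exact Ideal.mem_map_of_mem φ (hcm j')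

end Plane

end Literature.RingTheory.HilbertSamuel

end
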